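import Mathlib
import HarnessLib

/-!
# The additive content of a bimeasure on the semiring of measurable rectangles

Let `X, Y` be measurable spaces and `λ : Set Y → Measure X` a family of measures on `X` indexed by the subsets of `Y`
which is FINITELY ADDITIVE on disjoint measurable sets (`λ(B ∪ B') = λ(B) + λ(B')`, `λ(∅) = 0`) — a positive
BIMEASURE `(A, B) ↦ λ_B(A)` [cite: Bogachev2007, §1.4 and Exercise 3.10.70 (bimeasures)].  Then:

* `isSetSemiring_measurableProd` — the measurable rectangles `A ×ˢ B` form a semiring of sets (Mathlib has the
  π-system `isPiSystem_prod` and the generation `generateFrom_prod`, not the semiring property);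
* `sum_bimeasure_rect_eq` — ADDITIVITY ON RECTANGLE PARTITIONS: if finitely many pairwise disjoint measurable rectangles
  `Aᵢ ×ˢ Bᵢ` have union the rectangle `A₀ ×ˢ B₀`, then `∑ᵢ λ_{Bᵢ}(Aᵢ) = λ_{B₀}(A₀)` (refine the `Bᵢ` to the atoms of the
  finite algebra they generate; on each non-empty atom the `Aᵢ` above it partition `A₀`);
* `exists_addContent_bimeasure` — hence ONE additive content `m` on the semiring with `m(A ×ˢ B) = λ_B(A)`
  (Mathlib's `AddContent`; extend to the generated ring by `AddContent.supClosure`, and to a measure — under inner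
  regularity by a compact system — by `Literature.MeasureTheory.Radon.AddContent.exists_measure_eq_of_innerRegular`).

THEOREMS ONLY (the content is delivered existentially); no `sorry`; standard axioms.  Motivation in the tree: assembling the
Laplace–Fourier measure of a reflection-positive kernel from its slice bimeasure (crux ⟨stmt-QuantumFields-23125⟩, stub
`stub_laplaceFourier`).
-/

noncomputable section

open MeasureTheory Set
open scoped ENNReal

namespace Literature.MeasureTheory.Radon

variable {X Y : Type*} [MeasurableSpace X] [MeasurableSpace Y]

/-! ### Measurable rectangles form a semiring of sets -/

/-- **The measurable rectangles form a semiring of sets**: `∅` is a rectangle, rectangles are stable under intersection,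
and `(A ×ˢ B) \ (A' ×ˢ B') = (A \ A') ×ˢ B ⊔ (A ∩ A') ×ˢ (B \ B')`. [cite: Bogachev2007, §1.4] -/
theorem isSetSemiring_measurableProd :
    IsSetSemiring (image2 (· ×ˢ ·) {A : Set X | MeasurableSet A} {B : Set Y | MeasurableSet B}) := by
  classical
  refine ⟨⟨∅, MeasurableSet.empty, ∅, MeasurableSet.empty, by simp⟩, ?_, ?_⟩
  · rintro s ⟨A, hA, B, hB, rfl⟩ t ⟨A', hA', B', hB', rfl⟩
    exact ⟨A ∩ A', hA.inter hA', B ∩ B', hB.inter hB', Set.prod_inter_prod.symm⟩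
  · rintro s ⟨A, hA, B, hB, rfl⟩ t ⟨A', hA', B', hB', rfl⟩
    refine ⟨{(A \ A') ×ˢ B, (A ∩ A') ×ˢ (B \ B')}, ?_, ?_, ?_⟩
    · intro u hu
      simp only [Finset.coe_insert, Finset.coe_singleton, mem_insert_iff, mem_singleton_iff] at hu
      rcases hu with rfl | rfl
      · exact ⟨_, hA.diff hA', _, hB, rfl⟩
      · exact ⟨_, hA.inter hA', _, hB.diff hB', rfl⟩
    · intro u hu v hv huv
      simp only [Finset.coe_insert, Finset.coe_singleton, mem_insert_iff, mem_singleton_iff] at hu hv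
      have key : Disjoint ((A \ A') ×ˢ B) ((A ∩ A') ×ˢ (B \ B')) := by
        rw [Set.disjoint_prod]; left
        exact Set.disjoint_sdiff_left.mono_right inter_subset_right
      rcases hu with rfl | rfl <;> rcases hv with rfl | rfl
      · exact absurd rfl huv
      · exact key
      · exact key.symm
      · exact absurd rfl huv
    · ext ⟨x, y⟩
      simp only [Finset.coe_insert, Finset.coe_singleton, sUnion_insert, sUnion_singleton, mem_sdiff, mem_prod,
        mem_union, mem_inter_iff, not_and]
      tauto

/-! ### Additivity of a bimeasure on rectangle partitions -/

section Bimeasure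

variable (lam : Set Y → Measure X)

/-- Finite additivity of `B ↦ λ_B` over a finite pairwise disjoint family of measurable sets. [folklore] -/
private theorem lam_biUnion (h0 : lam ∅ = 0)
    (hadd : ∀ B B', MeasurableSet B → MeasurableSet B' → Disjoint B B' → lam (B ∪ B') = lam B + lam B')
    {κ : Type*} (S : Finset κ) (B : κ → Set Y) (hB : ∀ k, MeasurableSet (B k))
    (hdisj : Pairwise (fun k l => Disjoint (B k) (B l))) : lam (⋃ k ∈ S, B k) = ∑ k ∈ S, lam (B k) := by
  classical
  induction S using Finset.induction with
  | empty => simp [h0]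
  | insert k S hkS ih =>
    rw [Finset.set_biUnion_insert, Finset.sum_insert hkS, hadd _ _ (hB k)
      (Finset.measurableSet_biUnion _ fun l _ => hB l) ?_, ih]
    rw [Set.disjoint_iUnion₂_right]
    intro l hl
    exact hdisj (fun h => hkS (h ▸ hl))

/-- **Additivity of a bimeasure on rectangle partitions.**  If finitely many pairwise disjoint measurable rectangles
`Aᵢ ×ˢ Bᵢ` have union the measurable rectangle `A₀ ×ˢ B₀`, then `∑ᵢ λ_{Bᵢ}(Aᵢ) = λ_{B₀}(A₀)` for every family
`λ : Set Y → Measure X` finitely additive on disjoint measurable sets. [cite: Bogachev2007, §1.4] -/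
theorem sum_bimeasure_rect_eq (h0 : lam ∅ = 0)
    (hadd : ∀ B B', MeasurableSet B → MeasurableSet B' → Disjoint B B' → lam (B ∪ B') = lam B + lam B')
    {ι : Type*} [Fintype ι] (A : ι → Set X) (B : ι → Set Y) (hA : ∀ i, MeasurableSet (A i))
    (hB : ∀ i, MeasurableSet (B i)) (hdisj : Pairwise (fun i j => Disjoint (A i ×ˢ B i) (A j ×ˢ B j)))
    {A₀ : Set X} {B₀ : Set Y} (hB₀ : MeasurableSet B₀) (hU : (⋃ i, A i ×ˢ B i) = A₀ ×ˢ B₀) :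
    ∑ i, lam (B i) (A i) = lam B₀ A₀ := by
  classical
  -- normalise the `Bᵢ` inside `B₀`
  set B' : ι → Set Y := fun i => B i ∩ B₀ with hB'def
  have hB' : ∀ i, MeasurableSet (B' i) := fun i => (hB i).inter hB₀
  have hsub : ∀ i, A i ×ˢ B i ⊆ A₀ ×ˢ B₀ := fun i => hU ▸ subset_iUnion (fun i => A i ×ˢ B i) i
  have hval : ∀ i, lam (B i) (A i) = lam (B' i) (A i) := by
    intro i
    rcases (A i).eq_empty_or_nonempty with hAi | ⟨a, ha⟩
    · rw [hAi, measure_empty, measure_empty]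
    · have : B i ⊆ B₀ := fun b hb => ((hsub i) (mk_mem_prod ha hb)).2
      rw [hB'def]; dsimp only; rw [inter_eq_left.2 this]
  -- the atoms of the finite algebra generated by the `B'ᵢ` inside `B₀`
  set atom : Finset ι → Set Y := fun T => B₀ ∩ (⋂ i ∈ T, B' i) ∩ ⋂ i ∈ (Finset.univ \ T), (B' i)ᶜ with hatom
  have hatom_meas : ∀ T, MeasurableSet (atom T) := fun T =>
    (hB₀.inter (Finset.measurableSet_biInter _ fun i _ => hB' i)).inter
      (Finset.measurableSet_biInter _ fun i _ => (hB' i).compl)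
  have hmem_atom : ∀ (T : Finset ι) (q : Y), q ∈ atom T ↔ q ∈ B₀ ∧ ∀ i, (q ∈ B' i ↔ i ∈ T) := by
    intro T q
    simp only [hatom, mem_inter_iff, mem_iInter, mem_compl_iff, Finset.mem_sdiff, Finset.mem_univ, true_and]
    constructor
    · rintro ⟨⟨hq, h1⟩, h2⟩
      exact ⟨hq, fun i => ⟨fun h => by_contra fun hi => h2 i hi h, fun hi => h1 i hi⟩⟩
    · rintro ⟨hq, h⟩
      exact ⟨⟨hq, fun i hi => (h i).2 hi⟩, fun i hi hq' => hi ((h i).1 hq')⟩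
  have hatom_disj : Pairwise (fun T T' => Disjoint (atom T) (atom T')) := by
    intro T T' hTT'
    rw [Set.disjoint_left]
    intro q hq hq'
    rw [hmem_atom] at hq hq'
    apply hTT'
    ext i
    rw [← (hq.2 i), ← (hq'.2 i)]
  -- `B'ᵢ` is the union of the atoms above it, `B₀` the union of all atoms
  have hBi_eq : ∀ i, B' i = ⋃ T ∈ Finset.univ.filter (fun T => i ∈ T), atom T := by
    intro i
    ext q
    simp only [mem_iUnion, Finset.mem_filter, Finset.mem_univ, true_and, exists_prop]
    constructor
    · intro hq
      have hq0 : q ∈ B₀ := hq.2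
      refine ⟨Finset.univ.filter (fun j => q ∈ B' j), by simpa using hq, ?_⟩
      rw [hmem_atom]
      exact ⟨hq0, fun j => by simp⟩
    · rintro ⟨T, hiT, hqT⟩
      rw [hmem_atom] at hqT
      exact (hqT.2 i).2 hiT
  have hB0_eq : B₀ = ⋃ T ∈ (Finset.univ : Finset (Finset ι)), atom T := by
    ext q
    simp only [Finset.mem_univ, iUnion_true, mem_iUnion]
    constructor
    · intro hq
      refine ⟨Finset.univ.filter (fun j => q ∈ B' j), ?_⟩
      rw [hmem_atom]
      exact ⟨hq, fun j => by simp⟩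
    · rintro ⟨T, hqT⟩
      rw [hmem_atom] at hqT
      exact hqT.1
  -- above a non-empty atom `T`, the `Aᵢ`, `i ∈ T`, partition `A₀`
  have hsect : ∀ (T : Finset ι) (q : Y), q ∈ atom T →
      (∀ E, E ∈ A₀ ↔ ∃ i ∈ T, E ∈ A i) ∧ ∀ i ∈ T, ∀ j ∈ T, i ≠ j → Disjoint (A i) (A j) := by
    intro T q hq
    rw [hmem_atom] at hq
    have hqB : ∀ i, q ∈ B i ↔ i ∈ T := fun i => by
      rw [← hq.2 i, hB'def]; simp [hq.1]
    constructor
    · intro E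
      constructor
      · intro hE
        have : (E, q) ∈ ⋃ i, A i ×ˢ B i := by rw [hU]; exact mk_mem_prod hE hq.1
        obtain ⟨i, hi⟩ := mem_iUnion.1 this
        exact ⟨i, (hqB i).1 hi.2, hi.1⟩
      · rintro ⟨i, hiT, hE⟩
        exact ((hsub i) (mk_mem_prod hE ((hqB i).2 hiT))).1
    · intro i hi j hj hij
      rw [Set.disjoint_left]
      intro E hEi hEj
      exact Set.disjoint_left.1 (hdisj hij) (mk_mem_prod hEi ((hqB i).2 hi)) (mk_mem_prod hEj ((hqB j).2 hj))
  -- the computation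
  calc ∑ i, lam (B i) (A i) = ∑ i, lam (B' i) (A i) := Finset.sum_congr rfl fun i _ => hval i
    _ = ∑ i, ∑ T ∈ Finset.univ.filter (fun T => i ∈ T), lam (atom T) (A i) := by
        refine Finset.sum_congr rfl fun i _ => ?_
        rw [hBi_eq i, lam_biUnion lam h0 hadd _ atom hatom_meas hatom_disj, Measure.coe_finsetSum,
          Finset.sum_apply]
    _ = ∑ T, ∑ i ∈ T, lam (atom T) (A i) := by
        rw [Finset.sum_comm' (t' := Finset.univ) (s' := fun T => T)]
        intro i T
        simp
    _ = ∑ T, lam (atom T) A₀ := by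
        refine Finset.sum_congr rfl fun T _ => ?_
        rcases (atom T).eq_empty_or_nonempty with hT | ⟨q, hq⟩
        · simp [hT, h0]
        · obtain ⟨hcov, hdis⟩ := hsect T q hq
          have hA0 : A₀ = ⋃ i ∈ T, A i := by
            ext E; rw [hcov E]; simp
          rw [hA0, measure_biUnion_finset (fun i hi j hj hij => hdis i hi j hj hij) fun i _ => hA i]
    _ = lam B₀ A₀ := by
        rw [hB0_eq, lam_biUnion lam h0 hadd _ atom hatom_meas hatom_disj, Measure.coe_finsetSum,
          Finset.sum_apply]

/-! ### The content on the semiring of measurable rectangles -/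

omit [MeasurableSpace Y] in
/-- The value `λ_B(A)` depends only on the rectangle `A ×ˢ B`, not on its representation. [folklore] -/
private theorem bimeasure_wellDefined (h0 : lam ∅ = 0) {A A' : Set X} {B B' : Set Y}
    (h : A ×ˢ B = A' ×ˢ B') : lam B A = lam B' A' := by
  rcases Set.prod_eq_prod_iff.1 h with ⟨rfl, rfl⟩ | ⟨h1, h2⟩
  · rfl
  · have e1 : lam B A = 0 := by
      rcases h1 with rfl | rfl
      · exact measure_empty
      · rw [h0]; rfl
    have e2 : lam B' A' = 0 := by
      rcases h2 with rfl | rfl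
      · exact measure_empty
      · rw [h0]; rfl
    rw [e1, e2]

/-- **The additive content of a bimeasure on measurable rectangles**: for `λ : Set Y → Measure X` finitely additive on
disjoint measurable sets there is an additive content `m` (Mathlib `AddContent`) on the semiring of measurable rectangles
with `m(A ×ˢ B) = λ_B(A)`. [cite: Bogachev2007, §1.4] -/
theorem exists_addContent_bimeasure (h0 : lam ∅ = 0)
    (hadd : ∀ B B', MeasurableSet B → MeasurableSet B' → Disjoint B B' → lam (B ∪ B') = lam B + lam B') :
    ∃ m : AddContent ℝ≥0∞ (image2 (· ×ˢ ·) {A : Set X | MeasurableSet A} {B : Set Y | MeasurableSet B}),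
      ∀ (A : Set X) (B : Set Y), MeasurableSet A → MeasurableSet B → m (A ×ˢ B) = lam B A := by
  classical
  set C : Set (Set (X × Y)) := image2 (· ×ˢ ·) {A : Set X | MeasurableSet A} {B : Set Y | MeasurableSet B} with hC
  -- a choice of representation for every rectangle
  have hrep : ∀ s : Set (X × Y), s ∈ C → ∃ p : Set X × Set Y, MeasurableSet p.1 ∧ MeasurableSet p.2 ∧ s = p.1 ×ˢ p.2 := by
    rintro s ⟨A, hA, B, hB, rfl⟩
    exact ⟨(A, B), hA, hB, rfl⟩
  choose! rep hrep1 hrep2 hrep3 using hrep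
  set f : Set (X × Y) → ℝ≥0∞ := fun s => if s ∈ C then lam (rep s).2 (rep s).1 else 0 with hf
  have hfval : ∀ (A : Set X) (B : Set Y), MeasurableSet A → MeasurableSet B → f (A ×ˢ B) = lam B A := by
    intro A B hA hB
    have hs : A ×ˢ B ∈ C := ⟨A, hA, B, hB, rfl⟩
    simp only [hf, hs, if_true]
    exact bimeasure_wellDefined lam h0 (hrep3 _ hs).symm
  refine ⟨⟨f, ?_, ?_⟩, fun A B hA hB => hfval A B hA hB⟩
  · -- `f ∅ = 0`
    have := hfval ∅ ∅ MeasurableSet.empty MeasurableSet.empty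
    rw [Set.empty_prod] at this
    rw [this]; exact measure_empty
  · -- finite additivity on rectangle partitions
    intro I hI hdis hmem
    -- representations of the pieces and of the union
    have hIrep : ∀ u ∈ I, u = (rep u).1 ×ˢ (rep u).2 := fun u hu => hrep3 u (hI hu)
    obtain ⟨A₀, hA₀, B₀, hB₀, hU⟩ := hmem
    rw [← hU, hfval A₀ B₀ hA₀ hB₀]
    have hfu : ∀ u ∈ I, f u = lam (rep u).2 (rep u).1 := fun u hu => by
      conv_lhs => rw [hIrep u hu]
      exact hfval _ _ (hrep1 u (hI hu)) (hrep2 u (hI hu))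
    rw [Finset.sum_congr rfl hfu, ← Finset.sum_coe_sort]
    refine Eq.symm (sum_bimeasure_rect_eq lam h0 hadd (ι := (I : Set (Set (X × Y))))
      (fun u => (rep u).1) (fun u => (rep u).2) (fun u => hrep1 u (hI u.2)) (fun u => hrep2 u (hI u.2)) ?_ hB₀ ?_)
    · intro u v huv
      have h1 := hdis u.2 v.2 (fun h => huv (Subtype.ext h))
      rw [Function.onFun, id, id, hIrep u u.2, hIrep v v.2] at h1
      exact h1
    · have hU' : A₀ ×ˢ B₀ = ⋃₀ (I : Set (Set (X × Y))) := hU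
      rw [hU', sUnion_eq_iUnion]
      exact iUnion_congr fun u => (hIrep u u.2).symm

end Bimeasure

end Literature.MeasureTheory.Radon

end
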